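import Summits.ABC.StewartYu.ArchG3RecEndB
import Literature.GroupTheory.PermutationGroups.SmallIndexSubgroups
import HarnessLib

/-!
# The archimedean record of reference `ArchG3Rec` — exit B: the numeric side conditions for ALL `n ≥ 2`

Support file (elementary theorems; no named facts). Cell `abc-stewartyu`, route `YuMatveevShapeRat`, crux r2 `ArchCoreRat`
(stmt-ABC-20502, plan R41: p1 owns the capped exits); seat p1. `ArchG3RecEndB.exitB` left the two closed-form conditions
`hN0/hN1` on `c_L = 24C_bⁿK·yload_K/G + 2^{n+25} + 4K + 4·3ⁿ + 4n + 110` as hypotheses. Here they are DISCHARGED for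
every `n ≥ 2`: an integer majorant `c_L ≤ cLnat n` from `e⁸ < 2981`, `e¹⁰ < 22027`, `C_b = 32e < 87`, `K ≤ n·22027·2981ⁿ + 2`,
`yload_K ≤ 5G` (via `log₂ K ≤ 13n + 15`); then the two `ℕ`-inequalities by evaluation for `n ≤ 15` and by the crude
exponent chain `(n+1)! ≤ (n+1)ⁿ` (tree: `Literature.GroupTheory.PermutationGroups.factorial_succ_le_pow`), `k! ≤ (n+2)ᵏ`, `(n+2)⁵ ≤ 2^{n+5}` (`n ≥ 16`), `cLnat n ≤ 2^{20n+26}` beyond.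
Margins (exact, kit `HOME/p1/num`): ≥ 5.09 bits (`B0`, minimum at `n = 3`), ≥ 7.7 bits (`B1`). Output:
`ArchG3Rec.exitB_all (hn2 : 2 ≤ n) : ∀ d₀ ≤ 1, (n+1)!·2ⁿ·D₀·∏D < C(S₀+n−d₀, n−d₀)·(2X_fin+1)·(d₀!·D₀^{d₀})` —
clause (B) of `RecordArchW` with NO side condition.

## References
* [Nesterenko2003] Yu. V. Nesterenko, LNM 1819 (2003) — §5.2 Lemma 5.4, (5.17)–(5.18).
-/

noncomputable section

open Finset Real

namespace Summit.ABC.StewartYu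

namespace ArchG3Rec

open PadicG3Par (cG cM Cb cG_pos Cb_pos)
open ArchG3Par (G K SdK yloadK G_eq eight_le_G G_pos one_le_K K_pos two_G_le_yloadK yloadK_pos K_le)

/-! ### Integer majorants of the constants

Throughout, the integer majorants are `Knat n := n·22027·2981ⁿ + 2 ≥ K n` and
`cLnat n := 120·87ⁿ·Knat n + 4·Knat n + 2^{n+25} + 4·3ⁿ + 4n + 110 ≥ c_L`, always written out (no definitions). -/

/-- `e⁸ < 2981`. [folklore] -/
theorem exp_eight_lt : Real.exp 8 < 2981 := by
  have h := Real.exp_one_lt_d9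
  have h0 := (Real.exp_pos 1).le
  have e : Real.exp 8 = Real.exp 1 ^ 8 := by rw [← Real.exp_nat_mul]; norm_num
  rw [e]
  calc Real.exp 1 ^ 8 ≤ (2.7182818286 : ℝ) ^ 8 := by gcongr
    _ < 2981 := by norm_num

/-- `e¹⁰ < 22027`. [folklore] -/
theorem exp_ten_lt : Real.exp 10 < 22027 := by
  have h := Real.exp_one_lt_d9
  have h0 := (Real.exp_pos 1).le
  have e : Real.exp 10 = Real.exp 1 ^ 10 := by rw [← Real.exp_nat_mul]; norm_num
  rw [e]
  calc Real.exp 1 ^ 10 ≤ (2.7182818286 : ℝ) ^ 10 := by gcongr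
    _ < 22027 := by norm_num

/-- `C_b = 32e < 87`. [folklore] -/
theorem Cb_lt : Cb < 87 := by
  unfold Cb cM
  have := Real.exp_one_lt_d9
  push_cast
  nlinarith

/-- `K ≤ Knat` (`e^{8n+10} ≤ 2981ⁿ·22027`). [folklore] -/
theorem K_le_Knat (n : ℕ) : K n ≤ n * 22027 * 2981 ^ n + 2 := by
  have hK := K_le n
  have hG : G n + 2 = (n : ℝ) * 8 + 10 := by rw [G_eq]; ring
  have he : Real.exp (G n + 2) = Real.exp 8 ^ n * Real.exp 10 := by
    rw [hG, Real.exp_add, Real.exp_nat_mul]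
  have h8 := (Real.exp_pos 8).le
  have h1 : Real.exp (G n + 2) ≤ 2981 ^ n * 22027 := by
    rw [he]
    exact mul_le_mul (pow_le_pow_left₀ h8 exp_eight_lt.le n) exp_ten_lt.le (Real.exp_pos 10).le
      (by positivity)
  have hn : (0 : ℝ) ≤ n := Nat.cast_nonneg n
  have h2 : (K n : ℝ) ≤ ((n * 22027 * 2981 ^ n + 2 : ℕ) : ℝ) := by
    push_cast
    nlinarith
  exact_mod_cast h2

/-- `Knat < 2^{13n+16}`. [folklore] -/
theorem Knat_lt_two_pow (n : ℕ) : n * 22027 * 2981 ^ n + 2 < 2 ^ (13 * n + 16) := by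
  have h1 : n < 2 ^ n := Nat.lt_two_pow_self
  have h2 : 2981 ^ n ≤ 2 ^ (12 * n) := by
    rw [pow_mul]; exact Nat.pow_le_pow_left (by norm_num) n
  have h3 : n * 22027 * 2981 ^ n ≤ 2 ^ n * 2 ^ 15 * 2 ^ (12 * n) :=
    Nat.mul_le_mul (Nat.mul_le_mul h1.le (by norm_num)) h2
  have e : 2 ^ n * 2 ^ 15 * 2 ^ (12 * n) = 2 ^ (13 * n + 15) := by
    rw [← pow_add, ← pow_add]; ring_nf
  have h4 : 2 < 2 ^ (13 * n + 15) := by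
    calc 2 = 2 ^ 1 := by norm_num
      _ < 2 ^ (13 * n + 15) := Nat.pow_lt_pow_right (by norm_num) (by omega)
  have e2 : 2 ^ (13 * n + 16) = 2 ^ (13 * n + 15) + 2 ^ (13 * n + 15) := by
    rw [show 13 * n + 16 = (13 * n + 15) + 1 by ring, pow_succ]; ring
  calc n * 22027 * 2981 ^ n + 2 < 2 ^ n * 2 ^ 15 * 2 ^ (12 * n) + 2 ^ (13 * n + 15) :=
        Nat.add_lt_add_of_le_of_lt h3 h4
    _ = 2 ^ (13 * n + 16) := by rw [e, e2]

/-- `log₂ K ≤ 13n + 15`. [folklore] -/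
theorem log_two_K_le (n : ℕ) : Nat.log 2 (K n) ≤ 13 * n + 15 := by
  have h : K n < 2 ^ (13 * n + 16) := lt_of_le_of_lt (K_le_Knat n) (Knat_lt_two_pow n)
  have hK0 : K n ≠ 0 := Nat.one_le_iff_ne_zero.mp (one_le_K n)
  have := (Nat.log_lt_iff_lt_pow (by norm_num) hK0).2 h
  omega

/-- `Ŝ_K ≤ 14n + 39`. [folklore] -/
theorem SdK_le (n : ℕ) : SdK n ≤ 14 * n + 39 := by
  unfold SdK; have := log_two_K_le n; omega

/-- **`yload_K ≤ 5·G`** (`n ≥ 1`). [folklore] -/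
theorem yloadK_le_five_G (n : ℕ) (hn : 1 ≤ n) : yloadK n ≤ 5 * G n := by
  unfold yloadK
  rw [G_eq]
  have hS : (SdK n : ℝ) ≤ 14 * n + 39 := by exact_mod_cast SdK_le n
  have hl2 := Real.log_two_lt_d9
  have hl0 : 0 < Real.log 2 := Real.log_pos one_lt_two
  have hn1 : (1 : ℝ) ≤ n := by exact_mod_cast hn
  have hlog : Real.log ((n : ℝ) + 1) ≤ n := by
    have := Real.log_le_sub_one_of_pos (show (0 : ℝ) < n + 1 by positivity); linarith
  have h1 : ((SdK n : ℝ) + n + 1) * Real.log 2 ≤ (15 * n + 40) * 0.6931471808 :=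
    mul_le_mul (by linarith) hl2.le hl0.le (by positivity)
  nlinarith

/-- **`c_L ≤ cLnat`** (`n ≥ 1`). [folklore] -/
theorem cL_le_cLnat (n : ℕ) (hn : 1 ≤ n) :
    24 * Cb ^ n * K n * yloadK n / G n + 2 ^ (n + 25) + 4 * K n + 4 * 3 ^ n + 4 * n + 110 ≤
      ((120 * 87 ^ n * (n * 22027 * 2981 ^ n + 2) + 4 * (n * 22027 * 2981 ^ n + 2) + 2 ^ (n + 25) + 4 * 3 ^ n + 4 * n + 110 : ℕ) : ℝ) := by
  have hG := G_pos n
  have hy : yloadK n / G n ≤ 5 := by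
    rw [div_le_iff₀ hG]; linarith [yloadK_le_five_G n hn]
  have hy0 : 0 ≤ yloadK n / G n := div_nonneg (yloadK_pos n).le hG.le
  have hCb : Cb ^ n ≤ 87 ^ n := pow_le_pow_left₀ Cb_pos.le Cb_lt.le n
  have hK : (K n : ℝ) ≤ ((n * 22027 * 2981 ^ n + 2 : ℕ) : ℝ) := by exact_mod_cast K_le_Knat n
  have hK0 := (K_pos n).le
  push_cast at hK ⊢
  have h1 : 24 * Cb ^ n * K n * yloadK n / G n ≤ 120 * 87 ^ n * ((n : ℝ) * 22027 * 2981 ^ n + 2) := by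
    have e : 24 * Cb ^ n * K n * yloadK n / G n = 24 * Cb ^ n * K n * (yloadK n / G n) := by ring
    rw [e]
    calc 24 * Cb ^ n * (K n : ℝ) * (yloadK n / G n) ≤ 24 * 87 ^ n * ((n : ℝ) * 22027 * 2981 ^ n + 2) * 5 := by
          gcongr
      _ = 120 * 87 ^ n * ((n : ℝ) * 22027 * 2981 ^ n + 2) := by ring
  linarith

/-! ### The two `ℕ`-inequalities -/

/-- `(n+2)⁵ ≤ 2^{n+5}` for `n ≥ 16`. [folklore] -/
theorem pow_five_le_two_pow (n : ℕ) (hn : 16 ≤ n) : (n + 2) ^ 5 ≤ 2 ^ (n + 5) := by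
  induction n, hn using Nat.le_induction with
  | base => norm_num
  | succ m hm ih =>
    -- `(m+3)⁵ ≤ 2(m+2)⁵` for `m + 2 ≥ 18`
    have hk : 18 ≤ m + 2 := by omega
    set k := m + 2 with hk_def
    have h4 : 18 * k ^ 4 ≤ k ^ 5 := by
      rw [pow_succ]; rw [mul_comm]; exact Nat.mul_le_mul_left _ hk
    have h3 : 10 * k ^ 3 ≤ k ^ 4 := by
      rw [pow_succ, mul_comm]; exact Nat.mul_le_mul_left _ (by omega)
    have h2 : 10 * k ^ 2 ≤ k ^ 4 := by
      have : k ^ 4 = k ^ 2 * k ^ 2 := by ring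
      rw [this]; exact Nat.mul_le_mul_right _ (by nlinarith)
    have h1 : 5 * k ≤ k ^ 4 := by
      have : k ^ 4 = k ^ 3 * k := by ring
      rw [this]; exact Nat.mul_le_mul_right _ (by nlinarith)
    have h0 : 1 ≤ k ^ 4 := Nat.one_le_pow _ _ (by omega)
    have hstep : (k + 1) ^ 5 ≤ 2 * k ^ 5 := by nlinarith
    calc (m + 1 + 2) ^ 5 = (k + 1) ^ 5 := by rw [hk_def]
      _ ≤ 2 * k ^ 5 := hstep
      _ ≤ 2 * 2 ^ (m + 5) := Nat.mul_le_mul_left _ ih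
      _ = 2 ^ (m + 1 + 5) := by rw [show m + 1 + 5 = (m + 5) + 1 by ring, pow_succ]; ring

/-- `cLnat n ≤ 2^{20n+26}` (`n ≥ 1`). [folklore] -/
theorem cLnat_le_two_pow (n : ℕ) (hn : 1 ≤ n) :
    120 * 87 ^ n * (n * 22027 * 2981 ^ n + 2) + 4 * (n * 22027 * 2981 ^ n + 2) + 2 ^ (n + 25) + 4 * 3 ^ n + 4 * n + 110 ≤ 2 ^ (20 * n + 26) := by
  have hK := (Knat_lt_two_pow n).le
  have h87 : 87 ^ n ≤ 2 ^ (7 * n) := by rw [pow_mul]; exact Nat.pow_le_pow_left (by norm_num) n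
  have h3 : 3 ^ n ≤ 2 ^ (2 * n) := by rw [pow_mul]; exact Nat.pow_le_pow_left (by norm_num) n
  have hn2 : n < 2 ^ n := Nat.lt_two_pow_self
  have t1 : 120 * 87 ^ n * (n * 22027 * 2981 ^ n + 2) ≤ 2 ^ (20 * n + 23) := by
    calc 120 * 87 ^ n * (n * 22027 * 2981 ^ n + 2) ≤ 2 ^ 7 * 2 ^ (7 * n) * 2 ^ (13 * n + 16) := by gcongr; norm_num
      _ = 2 ^ (20 * n + 23) := by rw [← pow_add, ← pow_add]; ring_nf
  have t2 : 4 * (n * 22027 * 2981 ^ n + 2) ≤ 2 ^ (20 * n + 23) := by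
    calc 4 * (n * 22027 * 2981 ^ n + 2) ≤ 2 ^ 2 * 2 ^ (13 * n + 16) := by gcongr; norm_num
      _ = 2 ^ (13 * n + 18) := by rw [← pow_add]; ring_nf
      _ ≤ 2 ^ (20 * n + 23) := Nat.pow_le_pow_right (by norm_num) (by omega)
  have t3 : 2 ^ (n + 25) ≤ 2 ^ (20 * n + 23) := Nat.pow_le_pow_right (by norm_num) (by omega)
  have t4 : 4 * 3 ^ n ≤ 2 ^ (20 * n + 23) := by
    calc 4 * 3 ^ n ≤ 2 ^ 2 * 2 ^ (2 * n) := by gcongr; norm_num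
      _ = 2 ^ (2 * n + 2) := by rw [← pow_add]; ring_nf
      _ ≤ 2 ^ (20 * n + 23) := Nat.pow_le_pow_right (by norm_num) (by omega)
  have t5 : 4 * n + 110 ≤ 2 ^ (20 * n + 23) := by
    have h1 : 1 ≤ 2 ^ n := Nat.one_le_two_pow
    calc 4 * n + 110 ≤ 2 ^ 7 * 2 ^ n := by omega
      _ = 2 ^ (n + 7) := by rw [← pow_add]; ring_nf
      _ ≤ 2 ^ (20 * n + 23) := Nat.pow_le_pow_right (by norm_num) (by omega)
  have e : 2 ^ (20 * n + 26) = 8 * 2 ^ (20 * n + 23) := by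
    rw [show 20 * n + 26 = (20 * n + 23) + 3 by ring, pow_add]; ring
  omega

set_option exponentiation.threshold 4096 in
/-- **(B0) for all `n ≥ 2`**: `(n+1)!·n!·2^{n−1}·(n+2)^{4n}·cLnat ≤ (16(n+1))ⁿ·2^{(n+22)n}·2^{n+23}`. [folklore] -/
theorem numB0_nat (n : ℕ) (hn : 2 ≤ n) :
    (n + 1).factorial * n.factorial * 2 ^ (n - 1) * (n + 2) ^ (4 * n) *
        (120 * 87 ^ n * (n * 22027 * 2981 ^ n + 2) + 4 * (n * 22027 * 2981 ^ n + 2) + 2 ^ (n + 25) + 4 * 3 ^ n + 4 * n + 110) ≤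
      (16 * (n + 1)) ^ n * 2 ^ ((n + 22) * n) * 2 ^ (n + 23) := by
  rcases lt_or_ge n 16 with h16 | h16
  · interval_cases n <;> decide
  · have hn1 : 1 ≤ n := by omega
    have hf1 : (n + 1).factorial ≤ (n + 1) ^ n := Literature.GroupTheory.PermutationGroups.factorial_succ_le_pow n
    have hf2 : n.factorial ≤ (n + 2) ^ n := (Nat.factorial_le_pow n).trans (Nat.pow_le_pow_left (by omega) n)
    have h2 : 2 ^ (n - 1) ≤ 2 ^ n := Nat.pow_le_pow_right (by norm_num) (by omega)
    have h5 : (n + 2) ^ (5 * n) ≤ 2 ^ ((n + 5) * n) := by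
      rw [pow_mul, pow_mul]; exact Nat.pow_le_pow_left (pow_five_le_two_pow n h16) n
    have hc := cLnat_le_two_pow n hn1
    calc (n + 1).factorial * n.factorial * 2 ^ (n - 1) * (n + 2) ^ (4 * n) *
          (120 * 87 ^ n * (n * 22027 * 2981 ^ n + 2) + 4 * (n * 22027 * 2981 ^ n + 2) + 2 ^ (n + 25) + 4 * 3 ^ n + 4 * n + 110)
        ≤ (n + 1) ^ n * (n + 2) ^ n * 2 ^ n * (n + 2) ^ (4 * n) * 2 ^ (20 * n + 26) := by gcongr
      _ = (n + 1) ^ n * (n + 2) ^ (5 * n) * 2 ^ (21 * n + 26) := by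
          rw [show 5 * n = n + 4 * n by ring, pow_add, show 21 * n + 26 = n + (20 * n + 26) by ring,
            pow_add 2 n]; ring
      _ ≤ (n + 1) ^ n * 2 ^ ((n + 5) * n) * 2 ^ (21 * n + 26) := by gcongr
      _ = (n + 1) ^ n * 2 ^ ((n + 5) * n + 21 * n + 26) := by rw [pow_add]; ring
      _ ≤ (n + 1) ^ n * 2 ^ (4 * n + (n + 22) * n + (n + 23)) :=
          Nat.mul_le_mul_left _ (Nat.pow_le_pow_right (by norm_num) (by nlinarith))
      _ = (16 * (n + 1)) ^ n * 2 ^ ((n + 22) * n) * 2 ^ (n + 23) := by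
          rw [pow_add, pow_add, mul_pow, show (16 : ℕ) = 2 ^ 4 by norm_num, ← pow_mul]; ring

set_option exponentiation.threshold 4096 in
/-- **(B1) for all `n ≥ 2`**: `(n+1)!·(n−1)!·2ⁿ·(n+2)^{4(n−1)}·cLnat ≤ (16(n+1))^{n−1}·2^{(n+22)(n−1)}·2^{n+22}·2^{n+23}`.
[folklore] -/
theorem numB1_nat (n : ℕ) (hn : 2 ≤ n) :
    (n + 1).factorial * (n - 1).factorial * 2 ^ n * (n + 2) ^ (4 * (n - 1)) *
        (120 * 87 ^ n * (n * 22027 * 2981 ^ n + 2) + 4 * (n * 22027 * 2981 ^ n + 2) + 2 ^ (n + 25) + 4 * 3 ^ n + 4 * n + 110) ≤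
      (16 * (n + 1)) ^ (n - 1) * 2 ^ ((n + 22) * (n - 1)) * 2 ^ (n + 22) * 2 ^ (n + 23) := by
  rcases lt_or_ge n 16 with h16 | h16
  · interval_cases n <;> decide
  · obtain ⟨m, rfl⟩ : ∃ m, n = m + 1 := ⟨n - 1, by omega⟩
    simp only [Nat.add_sub_cancel]
    have hm : 15 ≤ m := by omega
    have hf1 : (m + 1 + 1).factorial ≤ (m + 2) ^ (m + 1) :=
      Literature.GroupTheory.PermutationGroups.factorial_succ_le_pow (m + 1)
    have hf2 : m.factorial ≤ (m + 3) ^ m := (Nat.factorial_le_pow m).trans (Nat.pow_le_pow_left (by omega) m)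
    have h5 : (m + 3) ^ (5 * m) ≤ 2 ^ ((m + 6) * m) := by
      rw [pow_mul, pow_mul]
      have := pow_five_le_two_pow (m + 1) h16
      exact Nat.pow_le_pow_left (by simpa [add_assoc] using this) m
    have hc := cLnat_le_two_pow (m + 1) (by omega)
    have hm2 : m + 2 ≤ 2 ^ m := by
      obtain ⟨k, rfl⟩ : ∃ k, m = k + 1 := ⟨m - 1, by omega⟩
      have h : k < 2 ^ k := Nat.lt_two_pow_self
      rw [pow_succ]; omega
    calc (m + 1 + 1).factorial * m.factorial * 2 ^ (m + 1) * (m + 1 + 2) ^ (4 * m) *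
          (120 * 87 ^ (m + 1) * ((m + 1) * 22027 * 2981 ^ (m + 1) + 2) + 4 * ((m + 1) * 22027 * 2981 ^ (m + 1) + 2) + 2 ^ (m + 1 + 25) + 4 * 3 ^ (m + 1) + 4 * (m + 1) + 110)
        ≤ (m + 2) ^ (m + 1) * (m + 3) ^ m * 2 ^ (m + 1) * (m + 3) ^ (4 * m) * 2 ^ (20 * (m + 1) + 26) := by
          gcongr
      _ = (m + 2) ^ m * (m + 2) * (m + 3) ^ (5 * m) * 2 ^ (21 * m + 47) := by
          rw [show 5 * m = m + 4 * m by ring, pow_add (m + 3), show 21 * m + 47 = (m + 1) + (20 * (m + 1) + 26) by ring,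
            pow_add 2 (m + 1), pow_succ]; ring
      _ ≤ (m + 2) ^ m * 2 ^ m * 2 ^ ((m + 6) * m) * 2 ^ (21 * m + 47) := by gcongr
      _ = (m + 2) ^ m * 2 ^ ((m + 6) * m + 22 * m + 47) := by rw [pow_add, pow_add]; ring
      _ ≤ (m + 2) ^ m * 2 ^ (4 * m + (m + 1 + 22) * m + (m + 1 + 22) + (m + 1 + 23)) :=
          Nat.mul_le_mul_left _ (Nat.pow_le_pow_right (by norm_num) (by nlinarith))
      _ = (16 * (m + 1 + 1)) ^ m * 2 ^ ((m + 1 + 22) * m) * 2 ^ (m + 1 + 22) * 2 ^ (m + 1 + 23) := by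
          rw [pow_add, pow_add, pow_add, mul_pow, show (16 : ℕ) = 2 ^ 4 by norm_num, ← pow_mul]; ring

/-! ### The discharge -/

/-- **`hN0` holds for every `n ≥ 2`.** [folklore] -/
theorem hN0_holds (n : ℕ) (hn : 2 ≤ n) :
    (((n + 1).factorial : ℕ) : ℝ) * ((n.factorial : ℕ) : ℝ) * 2 ^ (n - 1) * ((n : ℝ) + 2) ^ (4 * n) *
        (24 * Cb ^ n * K n * yloadK n / G n + 2 ^ (n + 25) + 4 * K n + 4 * 3 ^ n + 4 * n + 110) ≤
      (16 * ((n : ℝ) + 1)) ^ n * 2 ^ ((n + 22) * n) * 2 ^ (n + 23) := by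
  have hc := cL_le_cLnat n (by omega)
  have hN := numB0_nat n hn
  have hNr : (((n + 1).factorial * n.factorial * 2 ^ (n - 1) * (n + 2) ^ (4 * n) *
        (120 * 87 ^ n * (n * 22027 * 2981 ^ n + 2) + 4 * (n * 22027 * 2981 ^ n + 2) + 2 ^ (n + 25) + 4 * 3 ^ n + 4 * n + 110) : ℕ) : ℝ) ≤
      (((16 * (n + 1)) ^ n * 2 ^ ((n + 22) * n) * 2 ^ (n + 23) : ℕ) : ℝ) := by exact_mod_cast hN
  push_cast at hNr
  have h0 : (0 : ℝ) ≤ (((n + 1).factorial : ℕ) : ℝ) * ((n.factorial : ℕ) : ℝ) * 2 ^ (n - 1) * ((n : ℝ) + 2) ^ (4 * n) := by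
    positivity
  calc _ ≤ (((n + 1).factorial : ℕ) : ℝ) * ((n.factorial : ℕ) : ℝ) * 2 ^ (n - 1) * ((n : ℝ) + 2) ^ (4 * n) *
        ((120 * 87 ^ n * (n * 22027 * 2981 ^ n + 2) + 4 * (n * 22027 * 2981 ^ n + 2) + 2 ^ (n + 25) + 4 * 3 ^ n + 4 * n + 110 : ℕ) : ℝ) :=
        mul_le_mul_of_nonneg_left hc h0
    _ ≤ _ := by push_cast; exact hNr

/-- **`hN1` holds for every `n ≥ 2`.** [folklore] -/
theorem hN1_holds (n : ℕ) (hn : 2 ≤ n) :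
    (((n + 1).factorial : ℕ) : ℝ) * (((n - 1).factorial : ℕ) : ℝ) * 2 ^ n * ((n : ℝ) + 2) ^ (4 * (n - 1)) *
        (24 * Cb ^ n * K n * yloadK n / G n + 2 ^ (n + 25) + 4 * K n + 4 * 3 ^ n + 4 * n + 110) ≤
      (16 * ((n : ℝ) + 1)) ^ (n - 1) * 2 ^ ((n + 22) * (n - 1)) * 2 ^ (n + 22) * 2 ^ (n + 23) := by
  have hc := cL_le_cLnat n (by omega)
  have hN := numB1_nat n hn
  have hNr : (((n + 1).factorial * (n - 1).factorial * 2 ^ n * (n + 2) ^ (4 * (n - 1)) *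
        (120 * 87 ^ n * (n * 22027 * 2981 ^ n + 2) + 4 * (n * 22027 * 2981 ^ n + 2) + 2 ^ (n + 25) + 4 * 3 ^ n + 4 * n + 110) : ℕ) : ℝ) ≤
      (((16 * (n + 1)) ^ (n - 1) * 2 ^ ((n + 22) * (n - 1)) * 2 ^ (n + 22) * 2 ^ (n + 23) : ℕ) : ℝ) := by
    exact_mod_cast hN
  push_cast at hNr
  have h0 : (0 : ℝ) ≤ (((n + 1).factorial : ℕ) : ℝ) * (((n - 1).factorial : ℕ) : ℝ) * 2 ^ n * ((n : ℝ) + 2) ^ (4 * (n - 1)) := by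
    positivity
  calc _ ≤ (((n + 1).factorial : ℕ) : ℝ) * (((n - 1).factorial : ℕ) : ℝ) * 2 ^ n * ((n : ℝ) + 2) ^ (4 * (n - 1)) *
        ((120 * 87 ^ n * (n * 22027 * 2981 ^ n + 2) + 4 * (n * 22027 * 2981 ^ n + 2) + 2 ^ (n + 25) + 4 * 3 ^ n + 4 * n + 110 : ℕ) : ℝ) := mul_le_mul_of_nonneg_left hc h0
    _ ≤ _ := by push_cast; exact hNr

variable {n : ℕ} (P : ArchG3Rec n)

/-- **Exit B for `ArchG3Rec`, ALL `n ≥ 2`, no side condition**: clause (B) of `RecordArchW` in `exitB_of_bounds` shape —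
`(n+1)!·2ⁿ·D₀·∏ⱼDⱼ < C(S₀+n−d₀, n−d₀)·(2X_fin+1)·(d₀!·D₀^{d₀})` for `d₀ ≤ 1`. [cite: Nesterenko2003, §5.2 Lemma 5.4] -/
theorem exitB_all (hn2 : 2 ≤ n) :
    ∀ d₀ : ℕ, d₀ ≤ 1 →
      (n + 1).factorial * 2 ^ n * P.D₀ * ∏ j, P.D j <
        Nat.choose (P.S₀ + (n - d₀)) (n - d₀) * (2 * P.Xfin + 1) * (d₀.factorial * P.D₀ ^ d₀) :=
  P.exitB hn2 (hN0_holds n hn2) (hN1_holds n hn2)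

end ArchG3Rec

end Summit.ABC.StewartYu
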